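import Literature.Analysis.FluidPDE.DeterministicBatchelorSpectrum
import Literature.Analysis.FluidPDE.AlternatingSawtoothShearMixingProofs
import HarnessLib

/-!
# Liss–Mattingly 2026: proved bookkeeping for the typed statements

Companion (theorems only, no definitions, no named facts) of `DeterministicBatchelorSpectrum.lean`
(K. L. Liss, J. C. Mattingly, arXiv:2603.08904v1, [`LissMattingly2026`]):

* the printed field: `LissMattingly2026.field α` (typed as Elgindi–Liss–Mattingly's field with
  amplitude `-α`) IS `αU₁ = (0, 2α|x - 1/2|)` on the first half period and `αU₂ = (2α|y - 1/2|, 0)`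
  on the second (`field_of_mem_Ico_left/right`); time periodicity is
  `ElgindiLissMattingly2025.field_add_one (-α)` (not restated);
* `T_α⁻¹ ∘ T_α = id = T_α ∘ T_α⁻¹`, `Φ^α_{0,0} = id`, `Φ^α_{0,1} = T_α`, `ϕ^α_{t,t} = id`,
  `ϕ^α_{t,0} = (Φ^α_{0,t})⁻¹`, and the Duhamel solution starts at the datum (`solution_zero`);
* the Fourier-side functionals: `coeffSobolevNormSq s (coeff g) = ‖g‖²_{H^s}` for a genuine function
  (`coeffSobolevNormSq_coeff`, consistency with the tree's `eSobolevNorm`), `0 ∈ lowModes N`,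
  monotonicity of `lowModes`/`lowModeMass` in `N`, `lowModeMass ≥ 0`, `iterCoeff` at `n = 0`;
* the special forcing (2.12) is time-one periodic (`IsShearForcing.periodic`);
* Theorem 3.1 implies exponential mixing of `T_α` with `α`-dependent rate `c log α` for each fixed
  large `α` — the qualitative form (2.2) on `W^{1,∞}` (`LissMattingly2026_thm31.mixing`).

## References

* K. L. Liss, J. C. Mattingly, arXiv:2603.08904v1: §2 pp. 3–8, §3.1 p. 9. [`LissMattingly2026`]
-/

open MeasureTheory Set Filter Topology
open scoped ENNReal NNReal

noncomputable section

namespace Literature.Analysis.FluidPDE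

namespace LissMattingly2026

open FunctionSpaces ElgindiLissMattingly2025

/-! ## The field is the printed one -/

/-- On the first half period Liss–Mattingly's field is `αU₁ = (0, 2α|x - 1/2|)`.
[cite: LissMattingly2026, §2 pp. 3–4 (u_α = αU₁ on [0,1/2))] -/
theorem field_of_mem_Ico_left {t : ℝ} (ht : t ∈ Ico (0 : ℝ) (1 / 2)) (α : ℝ)
    (z : UnitAddTorus (Fin 2)) :
    field α t z = WithLp.toLp 2 ![0, 2 * α * |Torus.repr z 0 - 1 / 2|] := by
  rw [field, ElgindiLissMattingly2025.field_of_mem_Ico_left ht, fieldV]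
  congr 1
  funext i
  fin_cases i <;> simp

/-- On the second half period Liss–Mattingly's field is `αU₂ = (2α|y - 1/2|, 0)`.
[cite: LissMattingly2026, §2 pp. 3–4 (u_α = αU₂ on [1/2,1))] -/
theorem field_of_mem_Ico_right {t : ℝ} (ht : t ∈ Ico (1 / 2 : ℝ) 1) (α : ℝ)
    (z : UnitAddTorus (Fin 2)) :
    field α t z = WithLp.toLp 2 ![2 * α * |Torus.repr z 1 - 1 / 2|, 0] := by
  rw [field, ElgindiLissMattingly2025.field_of_mem_Ico_right ht, fieldH]
  congr 1
  funext i
  fin_cases i <;> simp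

/-! ## Flow identities -/

/-- `T_α⁻¹ ∘ T_α = id`. [cite: LissMattingly2026, §2 p. 4 (T_α)] -/
theorem timeOneInv_comp_timeOneMap (α : ℝ) : timeOneInv α ∘ timeOneMap α = id :=
  periodInv_comp_periodMap (-α)

/-- `T_α ∘ T_α⁻¹ = id`. [cite: LissMattingly2026, §2 p. 4 (T_α)] -/
theorem timeOneMap_comp_timeOneInv (α : ℝ) : timeOneMap α ∘ timeOneInv α = id :=
  periodMap_comp_periodInv (-α)

/-- `Φ^α_{0,0} = id`. [cite: LissMattingly2026, (2.1) p. 4 (Φ^α_{s,s}(z) = z)] -/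
@[simp]
theorem flow_zero (α : ℝ) : flow α 0 = id :=
  flowMap_zero (-α)

/-- `Φ^α_{0,1} = T_α`. [cite: LissMattingly2026, §2 p. 4 (T_α := Φ^α_{0,1})] -/
@[simp]
theorem flow_one (α : ℝ) : flow α 1 = timeOneMap α :=
  flowMap_one (-α)

/-- At integer times `Φ^α_{0,n} = T_α^[n]`. [cite: LissMattingly2026, §2 p. 4] -/
theorem flow_natCast (α : ℝ) (n : ℕ) : flow α n = (timeOneMap α)^[n] :=
  flowMap_natCast (-α) n

/-- `ϕ^α_{t,t} = id`. [cite: LissMattingly2026, §2.2.1 p. 7 (ϕ^α_{t,s} = (Φ^α_{s,t})⁻¹)] -/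
@[simp]
theorem backFlow_self (α t : ℝ) : backFlow α t t = id :=
  flowMap_comp_flowInv (-α) t

/-- `ϕ^α_{t,0} = (Φ^α_{0,t})⁻¹`. [cite: LissMattingly2026, §2.2.1 p. 7] -/
@[simp]
theorem backFlow_zero (α t : ℝ) : backFlow α t 0 = ElgindiLissMattingly2025.flowInv (-α) t := by
  simp [backFlow]

/-- The Duhamel solution starts at the datum: `ρ(0) = ρ₀`. [cite: LissMattingly2026, §2.2.1 p. 7 (Duhamel's formula)] -/
@[simp]
theorem solution_zero (α : ℝ) (F : ℝ → UnitAddTorus (Fin 2) → ℝ) (ρ₀ : UnitAddTorus (Fin 2) → ℝ) :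
    solution α F ρ₀ 0 = ρ₀ := by
  funext z
  simp [solution]

/-! ## Fourier-side functionals -/

/-- For a genuine function `g`, the coefficient-level `H^s` functional is the square of the tree's
`eSobolevNorm` of (the complexification of) `g` (so the typed `H^{-s}` clauses of Thm. 2.1/2.2 agree
with the tree's Sobolev scale on functions). [cite: LissMattingly2026, Thm. 2.1 (1)–(2) p. 5 (the H^{-s} norms)] -/
theorem coeffSobolevNormSq_coeff (s : ℝ) (g : UnitAddTorus (Fin 2) → ℝ) :
    coeffSobolevNormSq s (coeff g) = Torus.eSobolevNorm s (fun z => (g z : ℂ)) ^ 2 := by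
  rw [Torus.eSobolevNorm, ← ENNReal.rpow_natCast, ← ENNReal.rpow_mul]
  norm_num
  rfl

/-- The zero mode is a low mode. [cite: LissMattingly2026, Thm. 2.1 (3) p. 5 (Π_{≤N})] -/
theorem zero_mem_lowModes (N : ℕ) : (0 : Fin 2 → ℤ) ∈ lowModes N := by
  simp [lowModes, Torus.freqNormSq, Fintype.mem_piFinset]

/-- Membership in `lowModes N` is `|k|² ≤ N²` (the box condition is then automatic).
[cite: LissMattingly2026, Thm. 2.1 (3) p. 5 (Π_{≤N})] -/
theorem mem_lowModes_iff {N : ℕ} {k : Fin 2 → ℤ} :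
    k ∈ lowModes N ↔ Torus.freqNormSq k ≤ (N : ℝ) ^ 2 := by
  simp only [lowModes, Finset.mem_filter, Fintype.mem_piFinset, Finset.mem_Icc, and_iff_right_iff_imp]
  intro hk i
  have hi : ((k i : ℝ)) ^ 2 ≤ (N : ℝ) ^ 2 := by
    refine le_trans ?_ hk
    rw [Torus.freqNormSq]
    exact Finset.single_le_sum (f := fun j => ((k j : ℝ)) ^ 2) (fun j _ => sq_nonneg _)
      (Finset.mem_univ i)
  have habs : |(k i : ℝ)| ≤ N := abs_le_of_sq_le_sq' hi (Nat.cast_nonneg N) |>.2 |> fun h =>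
    abs_le.2 ⟨(abs_le_of_sq_le_sq' hi (Nat.cast_nonneg N)).1, h⟩
  have h' : |(k i : ℝ)| ≤ (N : ℤ) := by exact_mod_cast habs
  have h'' : |k i| ≤ (N : ℤ) := by exact_mod_cast h'
  exact abs_le.1 h''

/-- `lowModes` grows with `N`. [cite: LissMattingly2026, Thm. 2.1 (3) p. 5 (Π_{≤N})] -/
theorem lowModes_mono {N M : ℕ} (h : N ≤ M) : lowModes N ⊆ lowModes M := by
  intro k hk
  rw [mem_lowModes_iff] at hk ⊢
  exact hk.trans (by gcongr)

/-- `‖Π_{≤N} ρ‖² ≥ 0`. [cite: LissMattingly2026, (2.8) p. 5] -/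
theorem lowModeMass_nonneg (N : ℕ) (c : (Fin 2 → ℤ) → ℂ) : 0 ≤ lowModeMass N c :=
  Finset.sum_nonneg fun _ _ => sq_nonneg _

/-- `‖Π_{≤N} ρ‖²` is non-decreasing in `N`. [cite: LissMattingly2026, (2.8) p. 5] -/
theorem lowModeMass_mono {N M : ℕ} (h : N ≤ M) (c : (Fin 2 → ℤ) → ℂ) :
    lowModeMass N c ≤ lowModeMass M c :=
  Finset.sum_le_sum_of_subset_of_nonneg (lowModes_mono h) fun _ _ _ => sq_nonneg _

/-- At `n = 0` the iterate is the datum: `𝓕(K_α^0 ρ₀) = 𝓕(ρ₀)`. [cite: LissMattingly2026, (2.5) p. 4] -/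
@[simp]
theorem iterCoeff_zero (α : ℝ) (f ρ₀ : UnitAddTorus (Fin 2) → ℝ) :
    iterCoeff α f ρ₀ 0 = coeff ρ₀ := by
  funext k
  simp [iterCoeff]

/-- One step of the recursion `ρ_{n+1} = K_α(ρ_n)` on the Fourier side: the `(n+1)`-st iterate adds
the term `𝓕(f ∘ T_α^{-n})`. [cite: LissMattingly2026, (2.5) p. 4 (ρ_n = K_α(ρ_{n-1}))] -/
theorem iterCoeff_succ (α : ℝ) (f ρ₀ : UnitAddTorus (Fin 2) → ℝ) (n : ℕ) (k : Fin 2 → ℤ) :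
    iterCoeff α f ρ₀ (n + 1) k =
      coeff (fun z => ρ₀ ((timeOneInv α)^[n + 1] z)) k +
        (∑ m ∈ Finset.range n, termCoeff α f m k) + termCoeff α f n k := by
  rw [iterCoeff, Finset.sum_range_succ, add_assoc]

/-! ## The special forcing is periodic -/

/-- The forcing (2.12) `F(t,x,y) = η(t - ⌊t⌋) h(y)` is time-one periodic.
[cite: LissMattingly2026, Thm. 2.3 p. 7 ((2.12), "time-one periodic")] -/
theorem IsShearForcing.periodic {F : ℝ → UnitAddTorus (Fin 2) → ℝ} (hF : IsShearForcing F)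
    (t : ℝ) (z : UnitAddTorus (Fin 2)) : F (t + 1) z = F t z := by
  obtain ⟨η, h, -, -, -, -, -, -, -, hF⟩ := hF
  rw [hF, hF, Int.floor_add_one]
  push_cast
  ring_nf

end LissMattingly2026

open FunctionSpaces LissMattingly2026

/-- **Theorem 3.1 ⇒ the qualitative mixing (2.2) on `W^{1,∞}`**: for each fixed `α ≥ max α₀ 3`,
`T_α` mixes mean-zero `W^{1,∞}` observables exponentially with rate `c log α > 0`
(`e^{-cn log α} = e^{-(c log α) n}`). [cite: LissMattingly2026, Thm. 3.1 p. 9 and (2.2) p. 4] -/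
theorem LissMattingly2026_thm31.mixing (h : LissMattingly2026_thm31) :
    ∃ α₀ : ℝ, ∀ α : ℝ, α₀ ≤ α →
      ∃ C c' : ℝ, 0 < C ∧ 0 < c' ∧
        ∀ f g : UnitAddTorus (Fin 2) → ℝ, MemBoundedHolder 1 f → MemBoundedHolder 1 g →
          ∫ z, f z = 0 → ∫ z, g z = 0 → ∀ n : ℕ,
            |∫ z, f ((timeOneInv α)^[n] z) * g z| ≤
              C * Real.exp (-(c' * n)) * (eBoundedHolderNorm 1 f).toReal *
                (eBoundedHolderNorm 1 g).toReal := by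
  obtain ⟨c, C, hc, hC, α₀, hα⟩ := h
  refine ⟨max α₀ 3, fun α hαle => ?_⟩
  have hα₀ : α₀ ≤ α := le_trans (le_max_left _ _) hαle
  have h3 : (3 : ℝ) ≤ α := le_trans (le_max_right _ _) hαle
  have hlog : 0 < Real.log α := Real.log_pos (by linarith)
  refine ⟨C, c * Real.log α, hC, mul_pos hc hlog, fun f g hf hg hf0 hg0 n => ?_⟩
  have h1 := (hα α hα₀ f g hf hg hf0 hg0 n).1
  have heq : -(c * n * Real.log α) = -(c * Real.log α * n) := by ring
  rw [heq] at h1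
  exact h1

end Literature.Analysis.FluidPDE

end
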